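import Summits.HodgeConjecture.HodgeConjecture.Theses.MomentAmplification
import Summits.HodgeConjecture.HodgeConjecture.Theorems.TorelliForSymmetriesReflectionsDecide
import HarnessLib

/-!
# Route `MomentAmplification`, support `DensityForcesEquality` (stmt-HodgeConjecture-11039):
# the moment step

For any Betti–Hodge datum `B` and `X` smooth projective of dimension `n`, with
`m_N = dim ℚ·A^{Nn}_B(X^{2N})` and `h_N = dim Hdg^{Nn}_B(X^{2N})`: the half-or-all dichotomy
(`m_N = h_N` for all `N`, or for every `δ > 0` eventually `m_N ≤ (1/2 + δ) h_N`) together with the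
density property (`∃ δ > 0`, frequently `(1/2 + δ) h_N ≤ m_N`) forces `m_N = h_N` for all `N`.
Elementary: the second branch of the dichotomy contradicts density because `h_N ≥ 1` — the middle
degree `2Nn` of the smooth projective `2Nn`-fold `X^{2N}` carries a NON-ZERO rational algebraic class
(`exists_mem_ratAlgebraicClasses_ne_zero`: the unit, or a power of a hyperplane class, non-zero by
the positivity of the degree), which is a Hodge class (`algebraicClasses_le_hodgeClasses`).
-/

set_option linter.dupNamespace false

namespace Summit.HodgeConjecture.HodgeConjecture.Theorems

open Literature.AlgebraicGeometry.Motives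

/-- **The middle-degree Hodge classes of a smooth projective `2p`-fold are non-zero**: for any
Betti–Hodge datum, `1 ≤ dim_ℚ Hdgᵖ_B(Y)` when `dim Y = 2p` (indeed whenever `p ≤ dim Y`), witnessed
by a non-zero rational algebraic class. [cite: Kleiman1968AlgebraicCycles, §1.2 and §1.4] -/
theorem momentAmplification_finrank_hodgeClasses_pos (B : BettiHodgeData ℂ) {d : ℕ} {Y : SchemeOver ℂ}
    (hY : IsSmoothProjective d Y) {p : ℕ} (hp : p ≤ d) :
    0 < Module.finrank ℚ ((B.hodge hY (2 * p)).hodgeClasses (p : ℤ)) := by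
  haveI : Module.Finite ℚ (B.W.obj Y (2 * p)) := B.W.finite_obj hY (2 * p)
  obtain ⟨e, he, he0⟩ := exists_mem_ratAlgebraicClasses_ne_zero B.W hY hp
  have heH : e ∈ (B.hodge hY (2 * p)).hodgeClasses (p : ℤ) :=
    B.algebraicClasses_le_hodgeClasses hY p (B.W.ratAlgebraicClasses_le_algebraicClasses Y p he)
  exact Module.finrank_pos_iff_exists_ne_zero.mpr ⟨⟨e, heH⟩, fun h ↦ he0 (congrArg Subtype.val h)⟩

/-- **Support item `DensityForcesEquality` of route `MomentAmplification`** (stmt-HodgeConjecture-11039,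
the moment step): half-or-all dichotomy + density ⟹ `m_N = h_N` for all `N`. If the "all" branch
fails, the "half" branch at `δ/2` holds eventually while density at `δ` holds frequently; at a common
`N`, `(1/2 + δ) h_N ≤ m_N ≤ (1/2 + δ/2) h_N` with `h_N ≥ 1`
(`momentAmplification_finrank_hodgeClasses_pos`) — absurd. -/
theorem momentAmplification_densityForcesEquality_proof :
    Summit.HodgeConjecture.HodgeConjecture.Theses.MomentAmplification.DensityForcesEquality := by
  intro B n X hX pow hdich hdens
  rcases hdich with hall | hhalf
  · exact hall
  exfalso
  obtain ⟨δ, hδ, hfreq⟩ := hdens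
  have hev := hhalf (δ / 2) (half_pos hδ)
  obtain ⟨N, ⟨hN, hdensN⟩, hhalfN⟩ := (hfreq.and_eventually hev).exists
  have hle := hhalfN hN
  have hpos : (0 : ℝ) < (Module.finrank ℚ
      ((B.hodge hN (2 * (N * n))).hodgeClasses ((N * n : ℕ) : ℤ)) : ℝ) := by
    exact_mod_cast momentAmplification_finrank_hodgeClasses_pos B hN (by rw [Nat.mul_assoc]; omega)
  nlinarith [mul_pos hδ hpos]

end Summit.HodgeConjecture.HodgeConjecture.Theorems
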